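import Summits.CriticalPhenomena.PercolationContinuityZ3.Theorems.PercNearOneGluingNoHeavyLowerTailFourPointAtoms
import Literature.Probability.LatticeModels.ProdBernoulliAtomExpansion
import HarnessLib

/-!
# A vertex all of whose pairs have weight zero is almost surely cut off (helper for the three-port transfer class theorems)

Support file for crux `stmt-CriticalPhenomena-4575` (Conjecture W programme), seat `prim-l12-p6` gen 27; memo
`run/shared/lean/prim/prim-l12/FROM-prim-l12-p6-g27-PORT-TRANSFER.md` §3.  The class theorem `ConjWPort.q44_cells_of_terminal_ports`
(`…Q44PortTransfer`) takes the hypotheses `P_{w₀}(a↔b) = P_{w₀}(a↔c) = P_{w₀}(a↔y) = 0` for `w₀ = w[s(a,b)↦0][s(a,c)↦0][s(a,y)↦0]`.  This file supplies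
the elementary facts that turn "every neighbour of `a` of positive weight is a terminal" into those hypotheses:

* `ConjWPort.real_openConn_eq_zero_of_star_zero` — if every pair `s(a,u)`, `u ≠ a`, has weight `0`, then `P_w(a ↔ x) = 0` for every `x ≠ a`
  (an open path from `a` starts with an open pair at `a`; union bound `prodBernoulli_setOf_exists_mem_eq_zero`);
* `ConjWPort.star_zero_update₃` — if every pair `s(a,u)` with `u ∉ {a,b,c,y}` has weight `0`, then every pair `s(a,u)`, `u ≠ a`, has weight `0`
  under `w₀ = w[s(a,b)↦0][s(a,c)↦0][s(a,y)↦0]`;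
* `ConjWPort.real_openConn_update₃_eq_zero` — the three hypotheses of `q44_cells_of_terminal_ports` for such `w` (for `x ∈ {b,c,y}`, `x ≠ a`).
No sorries, no named facts, no definitions, standard axioms.
-/

noncomputable section

namespace Summit.CriticalPhenomena.PercolationContinuityZ3.Theorems

namespace ConjWPort

open MeasureTheory Set Literature.Probability.LatticeModels Literature.Probability.Percolation
open scoped Classical

variable {n : ℕ}

/-- **A vertex with no pair of positive weight is almost surely joined to nobody**: if `w s(a,u) = 0` for all `u ≠ a` then
`P_w(a ↔ x) = 0` for every `x ≠ a`. [folklore] -/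
theorem real_openConn_eq_zero_of_star_zero (w : Sym2 (Fin n) → unitInterval) {a x : Fin n} (hax : a ≠ x)
    (h0 : ∀ u, u ≠ a → (w s(a, u) : ℝ) = 0) :
    (prodBernoulli w).real (openConn a x) = 0 := by
  -- the star of `a`
  set F : Finset (Sym2 (Fin n)) := (Finset.univ.erase a).image (fun u => s(a, u)) with hF
  have hsub : (openConn a x : Set (BondConfig (Fin n))) ⊆ {ω | ∃ e ∈ F, e ∈ ω} := by
    intro ω hω
    obtain ⟨p⟩ := (hω : (openGraph ω).Reachable a x)
    cases p with
    | nil => exact absurd rfl hax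
    | cons hadj p' =>
      rename_i u
      rcases (openGraph_adj ω a u).1 hadj with ⟨hmem, hne⟩
      refine ⟨s(a, u), ?_, hmem⟩
      rw [hF, Finset.mem_image]
      exact ⟨u, Finset.mem_erase.2 ⟨fun h => hne h.symm, Finset.mem_univ u⟩, rfl⟩
  have hzero : prodBernoulli w {ω | ∃ e ∈ F, e ∈ ω} = 0 := by
    refine prodBernoulli_setOf_exists_mem_eq_zero w F ?_
    intro e he
    rw [hF, Finset.mem_image] at he
    obtain ⟨u, hu, rfl⟩ := he
    exact h0 u (Finset.mem_erase.1 hu).1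
  have hle : (prodBernoulli w).real (openConn a x) ≤ (prodBernoulli w).real {ω | ∃ e ∈ F, e ∈ ω} :=
    measureReal_mono hsub
  have h2 : (prodBernoulli w).real {ω : BondConfig (Fin n) | ∃ e ∈ F, e ∈ ω} = 0 := by
    rw [measureReal_def, hzero, ENNReal.toReal_zero]
  exact le_antisymm (h2 ▸ hle) measureReal_nonneg

/-- If every pair `s(a,u)` with `u ∉ {a,b,c,y}` has weight zero, then after closing `s(a,b), s(a,c), s(a,y)` every pair `s(a,u)`,
`u ≠ a`, has weight zero. [this work] -/
theorem star_zero_update₃ (w : Sym2 (Fin n) → unitInterval) (a b c y : Fin n)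
    (h0 : ∀ u, u ≠ a → u ≠ b → u ≠ c → u ≠ y → (w s(a, u) : ℝ) = 0) (u : Fin n) (hu : u ≠ a) :
    ((Function.update (Function.update (Function.update w s(a, b) 0) s(a, c) 0) s(a, y) 0) s(a, u) : ℝ) = 0 := by
  have key : ∀ v : Fin n, u ≠ v → s(a, u) ≠ s(a, v) := fun v hv h => hv (Sym2.congr_right.1 h)
  by_cases huy : u = y
  · subst huy; simp
  rw [Function.update_of_ne (key y huy)]
  by_cases huc : u = c
  · subst huc; simp
  rw [Function.update_of_ne (key c huc)]
  by_cases hub : u = b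
  · subst hub; simp
  rw [Function.update_of_ne (key b hub)]
  exact h0 u hu hub huc huy

/-- **The hypotheses of `q44_cells_of_terminal_ports` from "every neighbour of `a` is a terminal"**: if every pair `s(a,u)` with
`u ∉ {a,b,c,y}` has weight zero and `x ≠ a`, then `P_{w₀}(a ↔ x) = 0` for `w₀ = w[s(a,b)↦0][s(a,c)↦0][s(a,y)↦0]`. [this work] -/
theorem real_openConn_update₃_eq_zero (w : Sym2 (Fin n) → unitInterval) (a b c y : Fin n)
    (h0 : ∀ u, u ≠ a → u ≠ b → u ≠ c → u ≠ y → (w s(a, u) : ℝ) = 0) {x : Fin n} (hax : a ≠ x) :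
    (prodBernoulli (Function.update (Function.update (Function.update w s(a, b) 0) s(a, c) 0) s(a, y) 0)).real (openConn a x) = 0 :=
  real_openConn_eq_zero_of_star_zero _ hax (star_zero_update₃ w a b c y h0)

end ConjWPort

end Summit.CriticalPhenomena.PercolationContinuityZ3.Theorems
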